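import Mathlib
import Summits.Ventures.PercRepro2.SwMaster
import Summits.Ventures.PercRepro2.SwOutAll

/-!
# The two-hull master statement (MM): on `U = {h ∉ H_l}` the hull pairs of `l` and of `h` are
negatively correlated in the mirror sense (blind cell PercRepro2, night-4 g39, 2026-08-29;
proofs/NIGHT4-G39.md §1)

For a vertex `x` let its HULL PAIR be `(C_R(x), C_B(x))`, ordered by «first coordinate grows, second
shrinks» (`IsPairUpSet`, SwMaster.lean); an up-set of pairs is an event INCREASING in the red
colouring, its MIRROR `{(A, B) ∣ (B, A) ∈ 𝓦}` a decreasing one, and the global colour swap `blue`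
exchanges the two.  **(MM)**: for every up-set `𝓦l` of pairs for `l` and every up-set `𝓦h` of pairs
for `h`,

  `#{h ∉ H_l, (C_R(l), C_B(l)) ∈ 𝓦l, (C_R(h), C_B(h)) ∈ 𝓦h}
     ≤ #{h ∉ H_l, (C_R(l), C_B(l)) ∈ 𝓦l, (C_B(h), C_R(h)) ∈ 𝓦h}`

— given that `h` is in neither cluster of `l`, «`l`'s pair large» (red cluster large, blue cluster
small) and «`h`'s pair large» repel: the count is at most the count with `h`'s pair mirrored.
Equivalently `Σ_U X·Y ≤ 0` for `X = 1[𝓦l] − 1[mirror 𝓦l]`, `Y = 1[𝓦h] − 1[mirror 𝓦h]` (the swap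
identity `card_twoHullClass_mirror_mirror`).  The RIGID form `TwoHullMasterRigid` takes the pair
`(redEdges, blueEdges)` of `h` (the red edges inside `C_R(h)`, the blue edges inside `C_B(h)`).

(MM) is the common generalisation of the lane's master conditioning (M) (`SwMaster`: `𝓦l` general,
`𝓦h` a rectangle `{C_R(h) ∈ 𝓥}`, no region) and of the joint domination (JD) of NIGHT4-G6 §4.3
(`𝓦l` the side of `o`, `𝓦h` general); it gives row (SW) (`sw_of_twoHullMaster`) and, in the rigid
form, row 2′SW-ALL (`swAll_of_twoHullMasterRigid`) by the Hall theorems of the tree.  Census (own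
code mining/night-4/g39/, exact counts): principal × principal over every occurring generator
pair, every ordered `(l, h)` with `U ≠ ∅` — vertex form: ALL connected graphs with `n ≤ 7`
(`n = 7`: 853 graphs, 16,722 cases, 10,280,664 tests, kit j331368; `n ≤ 6`: 251,752 tests),
0 failures; rigid form (edge pairs on both sides): all graphs with `n ≤ 6` (3,195,576 tests)
and `n = 7, m ≤ 10` (350 graphs, 8,468 cases, 72,287,368 tests), 0 failures; random
1–3-generator up-sets on both sides, `n ≤ 6`: 116,740 tests, 0 failures; planted control (the
order «both coordinates grow» on the `h` side) fails 2,300 / 7,520 at `n = 5`.  A CONJECTURE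
typed, not a theorem.

* `hullPair`, `edgePair`, `mirror`, `IsPairUpSetE`, `twoHullClass`, `twoHullClassE`;
* **`TwoHullMaster`**, **`TwoHullMasterRigid`**, `TwoHullMaster_all`, `TwoHullMasterRigid_all`;
* `card_twoHullClass_mirror_mirror` — the swap identity;
* `sw_of_twoHullMaster`, `swAll_of_twoHullMasterRigid`, `sw_all_of_twoHullMaster_all`,
  `swAll_all_of_twoHullMasterRigid_all`.
-/

namespace Summit.Ventures.PercRepro2

namespace LocRows

open Hull

variable {V : Type*} {E : Type*} [Fintype E] [DecidableEq E]

open scoped Classical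

variable (ends : E → Sym2 V)

/-- The hull pair of a vertex `x`: its red cluster and its blue cluster. -/
def hullPair (ζ : Config E) (x : V) : Set V × Set V :=
  (cluster ends ζ x, cluster ends (blue ζ) x)

/-- The rigid hull pair of `x`: the red edges inside its red cluster and the blue edges inside its
blue cluster. -/
def edgePair (ζ : Config E) (x : V) : Set E × Set E :=
  (redEdges ends ζ x, blueEdges ends ζ x)

/-- The mirror of a set of pairs: the pairs whose swap lies in it. -/
def mirror {α : Type*} (𝓦 : Set (α × α)) : Set (α × α) := {p | (p.2, p.1) ∈ 𝓦}

/-- An up-set of pairs of edge sets in the order «first coordinate grows, second shrinks». -/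
def IsPairUpSetE (𝓦 : Set (Set E × Set E)) : Prop :=
  ∀ A A' B B' : Set E, A ⊆ A' → B' ⊆ B → (A, B) ∈ 𝓦 → (A', B') ∈ 𝓦

/-- The two-hull class: `h ∉ H_l`, the hull pair of `l` in `𝓦l`, the hull pair of `h` in `𝓦h`. -/
noncomputable def twoHullClass (l h : V) (𝓦l 𝓦h : Set (Set V × Set V)) : Finset (Config E) :=
  Finset.univ.filter fun ζ =>
    h ∉ hull ends ζ l ∧ hullPair ends ζ l ∈ 𝓦l ∧ hullPair ends ζ h ∈ 𝓦h

/-- The rigid two-hull class: `h ∉ H_l`, the hull pair of `l` in `𝓦l`, the rigid hull pair of `h`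
in `𝓦h`. -/
noncomputable def twoHullClassE (l h : V) (𝓦l : Set (Set V × Set V))
    (𝓦h : Set (Set E × Set E)) : Finset (Config E) :=
  Finset.univ.filter fun ζ =>
    h ∉ hull ends ζ l ∧ hullPair ends ζ l ∈ 𝓦l ∧ edgePair ends ζ h ∈ 𝓦h

/-- **(MM), the two-hull master statement**: for every up-set of pairs `𝓦l` (for `l`) and `𝓦h`
(for `h`), the two-hull class with `𝓦h` is at most as large as the one with `𝓦h` mirrored. -/
def TwoHullMaster (l h : V) : Prop :=
  ∀ 𝓦l 𝓦h : Set (Set V × Set V), IsPairUpSet 𝓦l → IsPairUpSet 𝓦h →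
    (twoHullClass ends l h 𝓦l 𝓦h).card ≤ (twoHullClass ends l h 𝓦l (mirror 𝓦h)).card

/-- **(MM), the rigid form**: the same with the rigid hull pair `(redEdges, blueEdges)` of `h`. -/
def TwoHullMasterRigid (l h : V) : Prop :=
  ∀ (𝓦l : Set (Set V × Set V)) (𝓦h : Set (Set E × Set E)), IsPairUpSet 𝓦l → IsPairUpSetE 𝓦h →
    (twoHullClassE ends l h 𝓦l 𝓦h).card ≤ (twoHullClassE ends l h 𝓦l (mirror 𝓦h)).card

variable {ends}

/-- Membership in the mirror. -/
lemma mem_mirror {α : Type*} {𝓦 : Set (α × α)} {p : α × α} : p ∈ mirror 𝓦 ↔ (p.2, p.1) ∈ 𝓦 :=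
  Iff.rfl

/-- The mirror is an involution. -/
@[simp] lemma mirror_mirror {α : Type*} (𝓦 : Set (α × α)) : mirror (mirror 𝓦) = 𝓦 := by
  ext p; simp [mem_mirror]

omit [Fintype E] [DecidableEq E] in
/-- The colour swap swaps the hull pair. -/
lemma hullPair_blue (ζ : Config E) (x : V) : hullPair ends (blue ζ) x = (hullPair ends ζ x).swap := by
  simp [hullPair, blue_blue]

omit [Fintype E] [DecidableEq E] in
/-- The colour swap swaps the rigid hull pair. -/
lemma edgePair_blue (ζ : Config E) (x : V) : edgePair ends (blue ζ) x = (edgePair ends ζ x).swap := by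
  simp [edgePair, blueEdges, blue_blue]

omit [Fintype E] [DecidableEq E] in
/-- The colour swap is injective. -/
lemma blue_injective : Function.Injective (blue : Config E → Config E) :=
  Function.Involutive.injective blue_blue

/-- Membership in the two-hull class. -/
lemma mem_twoHullClass {l h : V} {𝓦l 𝓦h : Set (Set V × Set V)} {ζ : Config E} :
    ζ ∈ twoHullClass ends l h 𝓦l 𝓦h ↔
      h ∉ hull ends ζ l ∧ hullPair ends ζ l ∈ 𝓦l ∧ hullPair ends ζ h ∈ 𝓦h := by
  simp only [twoHullClass, Finset.mem_filter, Finset.mem_univ, true_and]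

/-- Membership in the rigid two-hull class. -/
lemma mem_twoHullClassE {l h : V} {𝓦l : Set (Set V × Set V)} {𝓦h : Set (Set E × Set E)}
    {ζ : Config E} :
    ζ ∈ twoHullClassE ends l h 𝓦l 𝓦h ↔
      h ∉ hull ends ζ l ∧ hullPair ends ζ l ∈ 𝓦l ∧ edgePair ends ζ h ∈ 𝓦h := by
  simp only [twoHullClassE, Finset.mem_filter, Finset.mem_univ, true_and]

/-- The colour swap carries the two-hull class of `(𝓦l, 𝓦h)` to the one of the mirrors. -/
lemma blue_mem_twoHullClass_iff {l h : V} {𝓦l 𝓦h : Set (Set V × Set V)} {ζ : Config E} :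
    blue ζ ∈ twoHullClass ends l h 𝓦l 𝓦h ↔
      ζ ∈ twoHullClass ends l h (mirror 𝓦l) (mirror 𝓦h) := by
  rw [mem_twoHullClass, mem_twoHullClass, hull_blue, hullPair_blue, hullPair_blue]
  simp only [mem_mirror, Prod.swap]

/-- The colour swap carries the rigid two-hull class of `(𝓦l, 𝓦h)` to the one of the mirrors. -/
lemma blue_mem_twoHullClassE_iff {l h : V} {𝓦l : Set (Set V × Set V)}
    {𝓦h : Set (Set E × Set E)} {ζ : Config E} :
    blue ζ ∈ twoHullClassE ends l h 𝓦l 𝓦h ↔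
      ζ ∈ twoHullClassE ends l h (mirror 𝓦l) (mirror 𝓦h) := by
  rw [mem_twoHullClassE, mem_twoHullClassE, hull_blue, hullPair_blue, edgePair_blue]
  simp only [mem_mirror, Prod.swap]

/-- **The swap identity**: the two-hull class of the mirrors is the image of the class under the
colour swap. -/
lemma twoHullClass_mirror_mirror_eq_image (l h : V) (𝓦l 𝓦h : Set (Set V × Set V)) :
    twoHullClass ends l h (mirror 𝓦l) (mirror 𝓦h) = (twoHullClass ends l h 𝓦l 𝓦h).image blue := by
  ext ζ
  rw [Finset.mem_image]
  constructor
  · intro hζ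
    refine ⟨blue ζ, ?_, blue_blue ζ⟩
    rw [blue_mem_twoHullClass_iff]
    exact hζ
  · rintro ⟨ζ', hζ', rfl⟩
    rw [blue_mem_twoHullClass_iff, mirror_mirror, mirror_mirror]
    exact hζ'

/-- **The swap identity, counted**: `#{U, 𝓦l, 𝓦h} = #{U, mirror 𝓦l, mirror 𝓦h}`. -/
theorem card_twoHullClass_mirror_mirror (l h : V) (𝓦l 𝓦h : Set (Set V × Set V)) :
    (twoHullClass ends l h (mirror 𝓦l) (mirror 𝓦h)).card = (twoHullClass ends l h 𝓦l 𝓦h).card := by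
  rw [twoHullClass_mirror_mirror_eq_image, Finset.card_image_of_injective _ blue_injective]

/-- The rigid swap identity. -/
lemma twoHullClassE_mirror_mirror_eq_image (l h : V) (𝓦l : Set (Set V × Set V))
    (𝓦h : Set (Set E × Set E)) :
    twoHullClassE ends l h (mirror 𝓦l) (mirror 𝓦h) =
      (twoHullClassE ends l h 𝓦l 𝓦h).image blue := by
  ext ζ
  rw [Finset.mem_image]
  constructor
  · intro hζ
    refine ⟨blue ζ, ?_, blue_blue ζ⟩
    rw [blue_mem_twoHullClassE_iff]
    exact hζ
  · rintro ⟨ζ', hζ', rfl⟩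
    rw [blue_mem_twoHullClassE_iff, mirror_mirror, mirror_mirror]
    exact hζ'

/-- The rigid swap identity, counted. -/
theorem card_twoHullClassE_mirror_mirror (l h : V) (𝓦l : Set (Set V × Set V))
    (𝓦h : Set (Set E × Set E)) :
    (twoHullClassE ends l h (mirror 𝓦l) (mirror 𝓦h)).card =
      (twoHullClassE ends l h 𝓦l 𝓦h).card := by
  rw [twoHullClassE_mirror_mirror_eq_image, Finset.card_image_of_injective _ blue_injective]

omit [Fintype E] [DecidableEq E] in
/-- A rectangle `{A ∈ 𝓥}` in the first coordinate is an up-set of pairs. -/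
lemma isPairUpSet_fst {𝓥 : Set (Set V)} (h𝓥 : IsUpperSet 𝓥) :
    IsPairUpSet {p : Set V × Set V | p.1 ∈ 𝓥} := by
  intro A A' B B' hA _ hAB
  exact h𝓥 hA hAB

omit [Fintype E] [DecidableEq E] in
/-- A rectangle `{F ∈ 𝓔}` in the first coordinate is an up-set of pairs of edge sets. -/
lemma isPairUpSetE_fst {𝓔 : Set (Set E)} (h𝓔 : IsUpperSet 𝓔) :
    IsPairUpSetE {p : Set E × Set E | p.1 ∈ 𝓔} := by
  intro A A' B B' hA _ hAB
  exact h𝓔 hA hAB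

/-- The two-hull class of the side of `o` and a first-coordinate rectangle is the side
`Q = tgtU` filtered by the red cluster of `h`. -/
lemma twoHullClass_side_fst (l h o : V) (𝓥 : Set (Set V)) :
    twoHullClass ends l h {p : Set V × Set V | o ∈ p.1 ∧ o ∉ p.2} {p : Set V × Set V | p.1 ∈ 𝓥} =
      (tgtU ends l h {S : Set V | o ∈ S}).filter fun ζ => cluster ends ζ h ∈ 𝓥 := by
  ext ζ
  rw [mem_twoHullClass, Finset.mem_filter]
  simp only [tgtU, Finset.mem_filter, Finset.mem_univ, true_and, Set.mem_setOf_eq, hullPair]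
  tauto

/-- The mirrored rectangle: the side filtered by the blue cluster of `h`. -/
lemma twoHullClass_side_fst_mirror (l h o : V) (𝓥 : Set (Set V)) :
    twoHullClass ends l h {p : Set V × Set V | o ∈ p.1 ∧ o ∉ p.2}
        (mirror {p : Set V × Set V | p.1 ∈ 𝓥}) =
      (tgtU ends l h {S : Set V | o ∈ S}).filter fun ζ => cluster ends (blue ζ) h ∈ 𝓥 := by
  ext ζ
  rw [mem_twoHullClass, Finset.mem_filter]
  simp only [tgtU, Finset.mem_filter, Finset.mem_univ, true_and, Set.mem_setOf_eq, hullPair,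
    mem_mirror]
  tauto

/-- The rigid two-hull class of the side of `o` and a first-coordinate rectangle. -/
lemma twoHullClassE_side_fst (l h o : V) (𝓔 : Set (Set E)) :
    twoHullClassE ends l h {p : Set V × Set V | o ∈ p.1 ∧ o ∉ p.2} {p : Set E × Set E | p.1 ∈ 𝓔} =
      (tgtU ends l h {S : Set V | o ∈ S}).filter fun ζ => redEdges ends ζ h ∈ 𝓔 := by
  ext ζ
  rw [mem_twoHullClassE, Finset.mem_filter]
  simp only [tgtU, Finset.mem_filter, Finset.mem_univ, true_and, Set.mem_setOf_eq, hullPair,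
    edgePair]
  tauto

/-- The mirrored rigid rectangle: the side filtered by the blue edges of `h`. -/
lemma twoHullClassE_side_fst_mirror (l h o : V) (𝓔 : Set (Set E)) :
    twoHullClassE ends l h {p : Set V × Set V | o ∈ p.1 ∧ o ∉ p.2}
        (mirror {p : Set E × Set E | p.1 ∈ 𝓔}) =
      (tgtU ends l h {S : Set V | o ∈ S}).filter fun ζ => blueEdges ends ζ h ∈ 𝓔 := by
  ext ζ
  rw [mem_twoHullClassE, Finset.mem_filter]
  simp only [tgtU, Finset.mem_filter, Finset.mem_univ, true_and, Set.mem_setOf_eq, hullPair,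
    edgePair, mem_mirror]
  tauto

/-- The source side filtered by the blue cluster of `h` is the swap image of the target side
filtered by the red cluster of `h`. -/
lemma srcU_filter_blue_eq_image (l h o : V) (𝓥 : Set (Set V)) :
    ((srcU ends l h {S : Set V | o ∈ S}).filter fun ζ => cluster ends (blue ζ) h ∈ 𝓥) =
      ((tgtU ends l h {S : Set V | o ∈ S}).filter fun ζ => cluster ends ζ h ∈ 𝓥).image blue := by
  ext ζ
  rw [Finset.mem_image]
  constructor
  · intro hζ
    rw [Finset.mem_filter] at hζ
    refine ⟨blue ζ, ?_, blue_blue ζ⟩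
    rw [Finset.mem_filter, blue_mem_tgtU_iff]
    exact ⟨hζ.1, hζ.2⟩
  · rintro ⟨ζ', hζ', rfl⟩
    rw [Finset.mem_filter] at hζ' ⊢
    rw [blue_mem_srcU_iff, blue_blue]
    exact hζ'

/-- **(MM) gives row (SW)** through Hall's theorem. -/
theorem sw_of_twoHullMaster {l h : V} (o : V) (hm : TwoHullMaster ends l h) : Sw ends l h o := by
  refine sw_of_card_le ends l h o fun 𝓥 h𝓥 => ?_
  rw [srcU_filter_blue_eq_image, Finset.card_image_of_injective _ blue_injective,
    ← twoHullClass_side_fst, ← twoHullClass_side_fst_mirror]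
  exact hm _ _ (isPairUpSet_side o) (isPairUpSet_fst h𝓥)

/-- **The rigid (MM) gives row 2′SW-ALL** through the rigid Hall theorem. -/
theorem swAll_of_twoHullMasterRigid {l h : V} (o : V) (hm : TwoHullMasterRigid ends l h) :
    SwAll ends l h o := by
  refine exists_swAll_injection_of_card_le h _ fun 𝓔 h𝓔 => ?_
  rw [← twoHullClassE_side_fst, ← twoHullClassE_side_fst_mirror]
  exact hm _ _ (isPairUpSet_side o) (isPairUpSetE_fst h𝓔)

variable (ends)

/-- (MM) over all finite graphs and markings. -/
def TwoHullMaster_all : Prop :=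
  ∀ (V E : Type) [Fintype V] [DecidableEq V] [Fintype E] [DecidableEq E] (ends : E → Sym2 V)
    (l h : V), l ≠ h → TwoHullMaster ends l h

/-- The rigid (MM) over all finite graphs and markings. -/
def TwoHullMasterRigid_all : Prop :=
  ∀ (V E : Type) [Fintype V] [DecidableEq V] [Fintype E] [DecidableEq E] (ends : E → Sym2 V)
    (l h : V), l ≠ h → TwoHullMasterRigid ends l h

/-- `TwoHullMaster_all` gives `Sw_all`. -/
theorem sw_all_of_twoHullMaster_all (hm : TwoHullMaster_all) : Sw_all := by
  intro V E _ _ _ _ ends l h o hlh _ _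
  exact sw_of_twoHullMaster o (hm V E ends l h hlh)

/-- `TwoHullMasterRigid_all` gives `SwAll_all`. -/
theorem swAll_all_of_twoHullMasterRigid_all (hm : TwoHullMasterRigid_all) : SwAll_all := by
  intro V E _ _ _ _ ends l h o hlh _ _
  exact swAll_of_twoHullMasterRigid o (hm V E ends l h hlh)

end LocRows

end Summit.Ventures.PercRepro2
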